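import Literature.Analysis.Quadrature.DiscreteFourierTransformProperties

/-!
# Route FeketeSOS — crux `FeketeSOSHard` (stmt-ValiantsHypothesis-3996), line `paley-rip` v3:
# the half-spectrum energy floor kills near-zero-divisor pairs (anti-concentration mechanism, kernel form, part 1)

Context.  The open stub `stub_tameOperator` of the registered skeleton `Cruxes/FeketeSOSHard/Lines/paley_rip_v3.lean`
is, at rank `r = 2`, PRODUCT TAMENESS (repair census `Cruxes/FeketeSOSHard/Lines/paley-rip-stub3-census.md`, §4);
by the balanced two-squares certificate P1 it holds wherever pairs `a, b` supported in `S` are not WILD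
(`‖a‖₂‖b‖₂ ≤ O(#S)·‖a·b mod (X^p−1)‖_∞`).  Census §6 (W1)–(W3) proposes to bound wildness by spectral
anti-concentration.  This file is that mechanism with ONE clean invariant, the **half-spectrum energy floor**
(a hypothesis, never a definition): a nonnegative spectral density has floor `e` if every set of at least half of
the frequencies carries at least an `e`-fraction of its total.

* `floor_product` — (W1)–(W3) abstractly: nonnegative `X, Y` on an `N`-set with half floors `e < 1` satisfy
  `e²·(ΣX)(ΣY) ≤ N·Σ XY` (Markov split at the level `e·ΣX/N` plus the two floors);
* `conv_energy_ge_of_halfSpectrumFloor` — with `X = |û|²`, `Y = |v̂|²` (`û = ZMod.dft u`), Plancherel and the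
  convolution theorem (`Literature.Analysis.Fourier.sum_norm_sq_dft`, `Literature.Analysis.Quadrature.dft_cyclicConv`):
  `e²·‖u‖₂²·‖v‖₂² ≤ ‖u ⋆ v‖₂²` on `ℤ/N` — no near-zero-divisor pair has both factors with a floor.

Part 2 (`…PaleyRIPHalfSpectrum.lean`) turns this into `stub_tameOperator` at `r = 2` with exponent `1` on supports
with a floor.  Honest framing: CONDITIONAL rung — which supports have a floor bounded below is the open
anti-concentration question (census §6 (W5a)); intervals / arithmetic progressions have floor `→ 0`.  Nothing here
proves the stub, the engine, the crux, or anything about `VP ≠ VNP`.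
-/

set_option linter.dupNamespace false

namespace Summit.ValiantsHypothesis.ValiantsHypothesis.Theorems.FeketeSOSHardPaleyRIP

open Polynomial Finset
open scoped BigOperators

noncomputable section

section Floor

/-- **(W1)–(W3) of the census, abstract form.**  Let `X, Y ≥ 0` on a finite set of size `N`, and suppose both
have a *half floor* `e < 1`: every `B` with `2·#B ≥ N` carries `≥ e·ΣX` of `X` (resp. `≥ e·ΣY` of `Y`).  Then
`e²·(ΣX)(ΣY) ≤ N · Σ_i X_i Y_i`.  Proof: split at the level `t = e·ΣX/N`; if the set where `X > t` is at least
half, the `Y`-floor there gives `Σ XY ≥ t·e·ΣY`; otherwise the set where `X ≤ t` is more than half and the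
`X`-floor forces `X ≤ t` everywhere, whence `ΣX ≤ e·ΣX`, impossible for `e < 1` unless `ΣX = 0`. [folklore] -/
theorem floor_product {ι : Type*} [Fintype ι] [DecidableEq ι] (X Y : ι → ℝ) (hX : ∀ i, 0 ≤ X i)
    (hY : ∀ i, 0 ≤ Y i) (e : ℝ) (he0 : 0 ≤ e) (he1 : e < 1)
    (hfX : ∀ B : Finset ι, Fintype.card ι ≤ 2 * B.card → e * ∑ i, X i ≤ ∑ i ∈ B, X i)
    (hfY : ∀ B : Finset ι, Fintype.card ι ≤ 2 * B.card → e * ∑ i, Y i ≤ ∑ i ∈ B, Y i) :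
    e ^ 2 * (∑ i, X i) * (∑ i, Y i) ≤ (Fintype.card ι : ℝ) * ∑ i, X i * Y i := by
  set N : ℕ := Fintype.card ι with hNdef
  set TX : ℝ := ∑ i, X i with hTXdef
  set TY : ℝ := ∑ i, Y i with hTYdef
  have hTX0 : 0 ≤ TX := Finset.sum_nonneg fun i _ => hX i
  have hTY0 : 0 ≤ TY := Finset.sum_nonneg fun i _ => hY i
  have hP0 : 0 ≤ ∑ i, X i * Y i := Finset.sum_nonneg fun i _ => mul_nonneg (hX i) (hY i)
  have hRHS0 : 0 ≤ (N : ℝ) * ∑ i, X i * Y i := mul_nonneg (Nat.cast_nonneg _) hP0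
  -- trivial cases
  rcases hTX0.lt_or_eq with hTXpos | hTX
  swap
  · rw [← hTX]; simpa using hRHS0
  rcases he0.lt_or_eq with hepos | he
  swap
  · rw [← he]; simpa using hRHS0
  -- `N > 0`
  have hNpos : 0 < N := by
    obtain ⟨i, -, _⟩ := Finset.exists_ne_zero_of_sum_ne_zero (ne_of_gt hTXpos)
    exact Fintype.card_pos_iff.2 ⟨i⟩
  have hNpos' : (0 : ℝ) < N := by exact_mod_cast hNpos
  -- the level `t`
  set t : ℝ := e * TX / N with htdef
  have ht0 : 0 ≤ t := by positivity
  have hNt : (N : ℝ) * t = e * TX := by rw [htdef]; field_simp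
  set Lc : Finset ι := Finset.univ.filter (fun i => t < X i) with hLcdef
  set L : Finset ι := Finset.univ.filter (fun i => X i ≤ t) with hLdef
  have hLL : L.card + Lc.card = N := by
    have h := Finset.card_filter_add_card_filter_not (s := (Finset.univ : Finset ι)) (fun i => X i ≤ t)
    rw [Finset.card_univ] at h
    have hLc : (Finset.univ.filter fun i => ¬ X i ≤ t) = Lc := by
      rw [hLcdef]; congr 1; ext i; simp [not_le]
    rw [hLc] at h
    exact h
  by_cases hcase : N ≤ 2 * Lc.card
  · -- Case A: `X > t` on at least half; use the `Y`-floor there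
    have hYf := hfY Lc hcase
    have h1 : t * ∑ i ∈ Lc, Y i ≤ ∑ i ∈ Lc, X i * Y i := by
      rw [Finset.mul_sum]
      refine Finset.sum_le_sum fun i hi => ?_
      have hti : t < X i := (Finset.mem_filter.1 hi).2
      exact mul_le_mul_of_nonneg_right hti.le (hY i)
    have h2 : ∑ i ∈ Lc, X i * Y i ≤ ∑ i, X i * Y i :=
      Finset.sum_le_sum_of_subset_of_nonneg (Finset.subset_univ _) fun i _ _ => mul_nonneg (hX i) (hY i)
    calc e ^ 2 * TX * TY = (N * t) * (e * TY) := by rw [hNt]; ring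
      _ ≤ (N * t) * ∑ i ∈ Lc, Y i := mul_le_mul_of_nonneg_left hYf (by positivity)
      _ = N * (t * ∑ i ∈ Lc, Y i) := by ring
      _ ≤ N * ∑ i, X i * Y i := mul_le_mul_of_nonneg_left (h1.trans h2) hNpos'.le
  · -- Case B: `X ≤ t` on more than half; the `X`-floor forces `X ≤ t` everywhere, contradiction
    exfalso
    have hLhalf : N ≤ 2 * L.card := by omega
    have hXf := hfX L hLhalf
    have hsumL : ∑ i ∈ L, X i ≤ t * L.card := by
      have : ∑ i ∈ L, X i ≤ ∑ i ∈ L, t := Finset.sum_le_sum fun i hi => (Finset.mem_filter.1 hi).2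
      rwa [Finset.sum_const, nsmul_eq_mul, mul_comm] at this
    have hLN : (L.card : ℝ) ≤ N := by exact_mod_cast (by omega : L.card ≤ N)
    -- `e TX ≤ t #L ≤ t N = e TX`, so `#L = N`... in fact we only need `#L < N` is impossible:
    have hLc0 : Lc.card ≠ 0 := by
      intro h0
      -- then `X ≤ t` everywhere and `TX ≤ N t = e TX < TX`
      have hall : ∀ i, X i ≤ t := by
        intro i
        by_contra hi
        have : i ∈ Lc := Finset.mem_filter.2 ⟨Finset.mem_univ i, not_le.1 hi⟩
        rw [Finset.card_eq_zero] at h0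
        rw [h0] at this
        exact Finset.notMem_empty i this
      have hTXle : TX ≤ N * t := by
        have : ∑ i, X i ≤ ∑ _i : ι, t := Finset.sum_le_sum fun i _ => hall i
        rwa [Finset.sum_const, Finset.card_univ, nsmul_eq_mul] at this
      rw [hNt] at hTXle
      nlinarith
    have hLlt : (L.card : ℝ) < N := by
      have : L.card < N := by omega
      exact_mod_cast this
    have : e * TX < e * TX := by
      calc e * TX ≤ ∑ i ∈ L, X i := hXf
        _ ≤ t * L.card := hsumL
        _ < t * N := by
            rcases ht0.lt_or_eq with htpos | ht
            · exact mul_lt_mul_of_pos_left hLlt htpos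
            · exfalso
              -- `t = 0` forces `e TX = 0`
              have : e * TX = 0 := by rw [← hNt, ← ht, mul_zero]
              exact (mul_pos hepos hTXpos).ne' this
        _ = e * TX := by rw [mul_comm, hNt]
    exact lt_irrefl _ this

end Floor

section Fourier

open Literature.Analysis.Quadrature

variable {N : ℕ} [NeZero N]

/-- **No near-zero-divisor pair on a support with a half-spectrum floor.**  If `|û|²` and `|v̂|²`
(`û = ZMod.dft u`) both have the half floor `e < 1` (every set of at least `N/2` frequencies carries at least an
`e`-fraction of the spectral energy), then `e²·‖u‖₂²·‖v‖₂² ≤ ‖u ⋆ v‖₂²` for the cyclic convolution on `ℤ/N`.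
Proof: `floor_product` + Plancherel + the convolution theorem. [folklore] -/
theorem conv_energy_ge_of_halfSpectrumFloor (e : ℝ) (he0 : 0 ≤ e) (he1 : e < 1) (u v : ZMod N → ℂ)
    (hu : ∀ B : Finset (ZMod N), N ≤ 2 * B.card →
      e * ∑ k, ‖ZMod.dft u k‖ ^ 2 ≤ ∑ k ∈ B, ‖ZMod.dft u k‖ ^ 2)
    (hv : ∀ B : Finset (ZMod N), N ≤ 2 * B.card →
      e * ∑ k, ‖ZMod.dft v k‖ ^ 2 ≤ ∑ k ∈ B, ‖ZMod.dft v k‖ ^ 2) :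
    e ^ 2 * (∑ j, ‖u j‖ ^ 2) * (∑ j, ‖v j‖ ^ 2) ≤ ∑ n, ‖cyclicConv u v n‖ ^ 2 := by
  classical
  have hN : (0 : ℝ) < N := by exact_mod_cast Nat.pos_of_ne_zero (NeZero.ne N)
  have hcard : Fintype.card (ZMod N) = N := ZMod.card N
  have hfp := floor_product (fun k => ‖ZMod.dft u k‖ ^ 2) (fun k => ‖ZMod.dft v k‖ ^ 2)
    (fun k => sq_nonneg _) (fun k => sq_nonneg _) e he0 he1
    (fun B hB => hu B (by rwa [hcard] at hB)) (fun B hB => hv B (by rwa [hcard] at hB))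
  rw [hcard] at hfp
  -- Plancherel for `u`, `v`, `u ⋆ v` and the convolution theorem
  have hPu := Literature.Analysis.Fourier.sum_norm_sq_dft u
  have hPv := Literature.Analysis.Fourier.sum_norm_sq_dft v
  have hPc := Literature.Analysis.Fourier.sum_norm_sq_dft (cyclicConv u v)
  have hprod : ∑ k, ‖ZMod.dft u k‖ ^ 2 * ‖ZMod.dft v k‖ ^ 2 = ∑ k, ‖ZMod.dft (cyclicConv u v) k‖ ^ 2 := by
    refine Finset.sum_congr rfl fun k _ => ?_
    rw [dft_cyclicConv, norm_mul, mul_pow]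
  rw [hPu, hPv, hprod, hPc] at hfp
  -- `e² (N Σ|u|²)(N Σ|v|²) ≤ N (N Σ|u⋆v|²)`: cancel `N² > 0`
  have hN2 : (0 : ℝ) < (N : ℝ) * N := mul_pos hN hN
  have key : (N : ℝ) * N * (e ^ 2 * (∑ j, ‖u j‖ ^ 2) * (∑ j, ‖v j‖ ^ 2)) ≤
      (N : ℝ) * N * ∑ n, ‖cyclicConv u v n‖ ^ 2 := by
    have h := hfp
    ring_nf
    ring_nf at h
    linarith
  exact le_of_mul_le_mul_left key hN2

end Fourier

end

end Summit.ValiantsHypothesis.ValiantsHypothesis.Theorems.FeketeSOSHardPaleyRIP
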